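import Literature.Analysis.FluidPDE.PlanarGateTemplate
import Literature.Analysis.FluidPDE.QuasiSelfSimilarCellwiseStage
import HarnessLib

/-!
# The gate template as window fields: joint smoothness, and generator moves as cell moves

Topic `Literature/Analysis/FluidPDE`. Companion of `PlanarGateTemplate.lean` (the gate template
`GateC.VgT`, `GateC.ΘgT` of the typed-chain designs) and of `QuasiSelfSimilarCellwiseStage.lean`
(the cellwise stage of a generator move: `QuasiSelfSimilar.IsCellMove`, `IsCellFamily.of_moves`, whose
window fields at the faces must be jointly smooth, tangent, and vanishing at transversal offset `≥ δ`).
This file provides the two small bridges between them: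

* `GateC.contDiff_uncurry_VgT`, `GateC.contDiff_uncurry_ΘgT` — the template fields are jointly
  smooth in `(t, ζ)` (valid datum; smooth profile), so that they qualify as the universal window
  fields `Wv`, `Wθ` of `IsCellFamily.of_moves` (with `GateC.VgT_tangent`, `GateC.template_vanish`);
* `QuasiSelfSimilar.IsGeneratorMove.toCellMove` — a generator move (all clauses at all times,
  `QuasiSelfSimilarGeneratorMoves.lean`) is a cell move on `[0, 1]` for the face-independent window
  fields `(k, s) ↦ Vg k`, `Θg k` whenever the gate fields vanish at transversal offset `≥ δ`; in
  particular (`GateC.isCellMove_of_isGeneratorMove`) for the template gate fields.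

Folklore; no named facts. Infrastructure towards a discharge of `acm_compatible_blocks`
(`QuasiSelfSimilarCompatibleBlocks.lean`).

## References

* G. Alberti, G. Crippa, A. L. Mazzucato, *Exponential self-similar mixing by incompressible
  flows*, J. Amer. Math. Soc. 32 (2019), 445–490, §8.4 (c), §8.6, §8.10–8.11 (arXiv:1605.02090).
-/

noncomputable section

open Function Set Filter
open scoped Topology ContDiff

namespace Literature.Analysis.FluidPDE

namespace PlanarKinematics

open Gluing QuasiSelfSimilar

/-- The plane `ℝ²` as a Euclidean space. [folklore] -/
local notation "E²" => EuclideanSpace ℝ (Fin 2)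

namespace GateC

variable {C : GateC}

/-- **The stub slope is a smooth function of time.** [folklore] -/
theorem contDiff_Wt {n : ℕ∞} : ContDiff ℝ n C.Wt :=
  (C.W.contDiff_eval).comp (clock_contDiff _ _)

/-- **The logarithmic rate is a smooth function of time** (valid datum). [folklore] -/
theorem contDiff_rt (hC : C.validB = true) {n : ℕ∞} : ContDiff ℝ n C.rt := by
  have h1 : ContDiff ℝ n fun t => clockDeriv C.t₀ C.τ t * C.W.rate :=
    (clockDeriv_contDiff _ (τ_pos hC).ne').mul contDiff_const
  exact h1.div contDiff_Wt fun t => (Wt_pos hC t).ne'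

/-- The derivative of the transversal plateau is smooth. [folklore] -/
theorem contDiff_deriv_pT {n : ℕ∞} : ContDiff ℝ n (deriv C.pT) := by
  have h := pT_contDiff (C := C) (n := n + 1)
  exact h.deriv'

/-- A coordinate of the space variable is a smooth function on `ℝ × ℝ²`. [folklore] -/
theorem contDiff_coord (i : Fin 2) {n : WithTop ℕ∞} : ContDiff ℝ n fun p : ℝ × E² => p.2 i := by
  have e : (fun p : ℝ × E² => p.2 i) = (EuclideanSpace.proj i : E² →L[ℝ] ℝ) ∘ (Prod.snd : ℝ × E² → E²) := rfl
  rw [e]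
  exact (EuclideanSpace.proj i : E² →L[ℝ] ℝ).contDiff.comp contDiff_snd

/-- **The template stream function is jointly smooth.** [folklore] -/
theorem contDiff_uncurry_HgT (hC : C.validB = true) (k : Fin 2) : ContDiff ℝ ∞ (uncurry (C.HgT k)) := by
  have hrt : ContDiff ℝ ∞ fun p : ℝ × E² => C.rt p.1 := (contDiff_rt hC).comp contDiff_fst
  have hp : ∀ i, ContDiff ℝ ∞ fun p : ℝ × E² => C.pT (p.2 i) := fun i => pT_contDiff.comp (contDiff_coord i)
  have hk : k = 0 ∨ k = 1 := by fin_cases k <;> simp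
  rcases hk with rfl | rfl
  · have e : uncurry (C.HgT 0) = fun p : ℝ × E² => -C.rt p.1 * p.2 0 * p.2 1 * C.pT (p.2 1) := by
      funext p; simp [uncurry]
    rw [e]
    exact ((hrt.neg.mul (contDiff_coord 0)).mul (contDiff_coord 1)).mul (hp 1)
  · have e : uncurry (C.HgT 1) = fun p : ℝ × E² => C.rt p.1 * p.2 0 * p.2 1 * C.pT (p.2 0) := by
      funext p; simp [uncurry]
    rw [e]
    exact ((hrt.mul (contDiff_coord 0)).mul (contDiff_coord 1)).mul (hp 0)

/-- **The template velocity is jointly smooth.** [folklore] -/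
theorem contDiff_uncurry_VgT (hC : C.validB = true) (k : Fin 2) : ContDiff ℝ ∞ (uncurry (C.VgT k)) := by
  have hrt : ContDiff ℝ ∞ fun p : ℝ × E² => C.rt p.1 := (contDiff_rt hC).comp contDiff_fst
  have hp : ∀ i, ContDiff ℝ ∞ fun p : ℝ × E² => C.pT (p.2 i) := fun i => pT_contDiff.comp (contDiff_coord i)
  have hdp : ∀ i, ContDiff ℝ ∞ fun p : ℝ × E² => deriv C.pT (p.2 i) := fun i => contDiff_deriv_pT.comp (contDiff_coord i)
  have hk : k = 0 ∨ k = 1 := by fin_cases k <;> simp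
  rcases hk with rfl | rfl
  · have e : uncurry (C.VgT 0) = fun p : ℝ × E² =>
        vec2 (-C.rt p.1 * p.2 0 * (C.pT (p.2 1) + p.2 1 * deriv C.pT (p.2 1))) (C.rt p.1 * p.2 1 * C.pT (p.2 1)) := by
      funext p; simp [uncurry]
    rw [e]
    exact contDiff_vec2 ((hrt.neg.mul (contDiff_coord 0)).mul ((hp 1).add ((contDiff_coord 1).mul (hdp 1))))
      ((hrt.mul (contDiff_coord 1)).mul (hp 1))
  · have e : uncurry (C.VgT 1) = fun p : ℝ × E² =>
        vec2 (C.rt p.1 * p.2 0 * C.pT (p.2 0)) (-C.rt p.1 * p.2 1 * (C.pT (p.2 0) + p.2 0 * deriv C.pT (p.2 0))) := by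
      funext p; simp [uncurry]
    rw [e]
    exact contDiff_vec2 ((hrt.mul (contDiff_coord 0)).mul (hp 0))
      ((hrt.neg.mul (contDiff_coord 1)).mul ((hp 0).add ((contDiff_coord 0).mul (hdp 0))))

/-- **The template scalar is jointly smooth** (smooth profile). [folklore] -/
theorem contDiff_uncurry_ΘgT (hC : C.validB = true) {G : ℝ → ℝ} (hG : ContDiff ℝ ∞ G) (k : Fin 2) :
    ContDiff ℝ ∞ (uncurry (C.ΘgT G k)) := by
  have hW : ContDiff ℝ ∞ fun p : ℝ × E² => C.Wt p.1 := contDiff_Wt.comp contDiff_fst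
  have hp : ∀ i, ContDiff ℝ ∞ fun p : ℝ × E² => C.pT (p.2 i) := fun i => pT_contDiff.comp (contDiff_coord i)
  have hq : ∀ i, ContDiff ℝ ∞ fun p : ℝ × E² => G (p.2 i / C.Wt p.1) := fun i =>
    hG.comp ((contDiff_coord i).div hW fun p => (Wt_pos hC p.1).ne')
  have hk : k = 0 ∨ k = 1 := by fin_cases k <;> simp
  rcases hk with rfl | rfl
  · have e : uncurry (C.ΘgT G 0) = fun p : ℝ × E² => C.pT (p.2 1) * G (p.2 1 / C.Wt p.1) := by
      funext p; simp [uncurry]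
    rw [e]; exact (hp 1).mul (hq 1)
  · have e : uncurry (C.ΘgT G 1) = fun p : ℝ × E² => C.pT (p.2 0) * G (p.2 0 / C.Wt p.1) := by
      funext p; simp [uncurry]
    rw [e]; exact (hp 0).mul (hq 0)

end GateC

end PlanarKinematics

/-! ## Generator moves as cell moves -/

namespace QuasiSelfSimilar

variable {V : ℝ → EuclideanSpace ℝ (Fin 2) → EuclideanSpace ℝ (Fin 2)} {Θ : ℝ → EuclideanSpace ℝ (Fin 2) → ℝ}
  {gate : Fin 2 → Bool → Bool} {Vg : Fin 2 → ℝ → EuclideanSpace ℝ (Fin 2) → EuclideanSpace ℝ (Fin 2)}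
  {Θg : Fin 2 → ℝ → EuclideanSpace ℝ (Fin 2) → ℝ} {δ : ℝ}

/-- **A generator move is a cell move on `[0, 1]`** for the face-independent window fields
`(k, s) ↦ (Vg k, Θg k)`, provided the gate fields vanish at transversal offset `≥ δ`. [folklore] -/
theorem IsGeneratorMove.toCellMove (h : IsGeneratorMove V Θ gate Vg Θg δ)
    (hW : ∀ (k : Fin 2) (t : ℝ) (ζ : EuclideanSpace ℝ (Fin 2)), (∃ j, j ≠ k ∧ δ ≤ |ζ j|) → Vg k t ζ = 0 ∧ Θg k t ζ = 0) :
    IsCellMove (Icc 0 1) V Θ gate (fun k _ => Vg k) (fun k _ => Θg k) δ where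
  smooth_velocity := h.smooth_velocity
  smooth_scalar := h.smooth_scalar
  divFree := h.divFree
  transport := h.transport
  abs_le := h.abs_le
  vanish t z k s hz hw := h.vanish t z k s hz hw
  eq_gate t z k s hg hz hw := h.eq_gate t z k s hg hz hw
  W_vanish k _ t ζ hζ := hW k t ζ hζ

/-- **A generator move with the template gate fields is a cell move on `[0, 1]`** (valid
template datum). [folklore] -/
theorem _root_.Literature.Analysis.FluidPDE.PlanarKinematics.GateC.isCellMove_of_isGeneratorMove
    {C : PlanarKinematics.GateC} {G : ℝ → ℝ} (hC : C.validB = true)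
    (h : IsGeneratorMove V Θ gate C.VgT (C.ΘgT G) C.δ) :
    IsCellMove (Icc 0 1) V Θ gate (fun k _ => C.VgT k) (fun k _ => C.ΘgT G k) C.δ :=
  h.toCellMove fun k t _ hζ => PlanarKinematics.GateC.template_vanish hC G k t hζ

end QuasiSelfSimilar

end Literature.Analysis.FluidPDE
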